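import Literature.Barriers.NavierStokesRegularity.SharpLpLinftyNonuniquenessIteration
import Literature.Analysis.FluidPDE.NavierStokesReynoldsMainIterationProofs
import HarnessLib

/-!
# Cheskidov–Luo 2022, Thm. 1.7 (`CheskidovLuo2022MainTheorem`) — discharged

Theorem-only glue file (no definitions, no named facts, no `sorry`) **discharging the named fact
`Literature.Barriers.NavierStokesRegularity.CheskidovLuo2022MainTheorem`**
(`SharpLpLinftyNonuniqueness.lean`), the rendering of Thm. 1.7 of A. Cheskidov, X. Luo, *Sharp
nonuniqueness for the Navier–Stokes equations*, Invent. Math. 229 (2022) 987–1054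
= arXiv:2009.06596 (numbering of the held arXiv copy: Thm. 1.7 p. 5, proof §2.6 pp. 11–13).

The printed proof of Thm. 1.7 (§2.6) assumes the main iteration, Prop. 2.2, and passes to the
limit of the iterates; that passage is the accepted, proved reduction
`CheskidovLuo2022MainTheorem_of_mainIteration`
(`SharpLpLinftyNonuniquenessIteration.lean`, with the limit theory of
`Literature/Analysis/FluidPDE/NavierStokesReynoldsLimit`, `…WeakLimit`, `MixedNormSeries`):

* `(∀ n, Torus.CheskidovLuo2022MainIteration (d := Fin n)) → CheskidovLuo2022MainTheorem`.

Prop. 2.2 itself (`Torus.CheskidovLuo2022MainIteration`,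
`Literature/Analysis/FluidPDE/NavierStokesReynolds`) is now a theorem of the tree in every
dimension: `Torus.CheskidovLuo2022MainIteration_holds`
(`Literature/Analysis/FluidPDE/NavierStokesReynoldsMainIterationProofs`: Prop. 3.1
`Torus.CheskidovLuo2022Concentration_holds` and Prop. 4.1
`Torus.CheskidovLuo2022ConvexIntegration_holds` assembled by
`Torus.CheskidovLuo2022MainIteration_of_steps`, "It is clear that Proposition 2.2 follows from
Proposition 3.1 and Proposition 4.1", §4). Feeding it to the reduction closes Thm. 1.7:
`CheskidovLuo2022MainTheorem_holds`. (The barrier Thm. 1.6, `SharpLpLinftyNonuniqueness_holds`,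
is discharged along the same chain in `SharpLpLinftyNonuniquenessProofs.lean`.)

This discharge cannot be appended to `SharpLpLinftyNonuniqueness.lean` (the reduction file
imports it), and is kept out of `SharpLpLinftyNonuniquenessIteration.lean` so that the §2.6 limit
argument does not acquire the §§3–5 construction (`CLConvexIntegration` and its imports) in its
import closure.

## References

* A. Cheskidov, X. Luo, *Sharp nonuniqueness for the Navier–Stokes equations*, Invent. Math. 229
  (2022), 987–1054; arXiv:2009.06596: Thm. 1.7 (p. 5), its proof §2.6 (pp. 11–13), Prop. 2.2,
  Prop. 3.1, Prop. 4.1. [`CheskidovLuo2022`]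
-/

noncomputable section

namespace Literature.Barriers.NavierStokesRegularity

/-- **Cheskidov–Luo 2022, Thm. 1.7, PROVED** (for the rendering `CheskidovLuo2022MainTheorem`, see
its docstring): for `n ≥ 2`, `T > 0`, `1 ≤ p < 2`, `ε > 0` and a smooth, divergence-free,
zero-mean field `v` on `[0, T] × 𝕋ⁿ` there is a weak solution `u` of the Navier–Stokes equations
on `[0, T]` with datum `v(0)` (`Torus.IsWeakNSSolutionWithDataOn`), of zero mean for a.e. `t`, in
`L^p(0,T; L^∞)`, coinciding on some `[0, τ]`, `τ > 0`, with a classical solution from `v(0)`,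
smooth on an open set of times `I ⊆ [0, T]` with `dim_𝓗 ([0, T] ∖ I) ≤ ε`, and with
`‖u - v‖_{L^p(0,T;L^∞)} ≤ ε`. Proof: the §2.6 assembly
`CheskidovLuo2022MainTheorem_of_mainIteration` applied to the proved main iteration Prop. 2.2,
`Torus.CheskidovLuo2022MainIteration_holds`, in every dimension `Fin n`.
[cite: CheskidovLuo2022, Thm. 1.7; proof §2.6 via Prop. 2.2] -/
theorem CheskidovLuo2022MainTheorem_holds : CheskidovLuo2022MainTheorem :=
  CheskidovLuo2022MainTheorem_of_mainIteration fun _ =>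
    Literature.Analysis.FluidPDE.Torus.CheskidovLuo2022MainIteration_holds

end Literature.Barriers.NavierStokesRegularity

end
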